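/-
Copyright (c) 2026 the pub-hodgecm-mathlib formalisation cell (harness21).  Prover seat hodgecm-mathlib-K2E3-p14 (g4) ((SC-an) line lead), HCML Track B «K2-LIT»
(build stream 29), h413 = `stmt-HodgeConjecture-24833`, line `K2_E3_EllipticInputs`, unit U12 «Characters», socket #11 road (11-SC), letter (SC-an), road «FC»
(FINITE CONJUGATION MEASURE, RULINGS #15 ∕ MAP v5), brick (FC-6) HEAD «ON THE BOX, A COMPACT CENTRALISER FORCES A DIAGONAL COLLISION» = (FC-6a) ∘ (FC-6b).  2026-09-04.
-/
import Summits.HodgeConjecture.HodgeConjecture.Theorems.K2E3NearSingularOfCompactCentralizer   -- (FC-6b) FILE 2 (this seat): `exists_v_sub_lt_of_isCompact_centralizer_of_eigenvalues`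
import Summits.HodgeConjecture.HodgeConjecture.Theorems.K2E3NearTriangularEigenvalues           -- ★ (FC-6a) p857208 (K2E5-p01 (g4)): `exists_eigenvalues_near_diagonal`
import HarnessLib

/-!
# h413 ∕ Track B «K2-LIT», road «FC», brick (FC-6) — THE BOX LEMMA: `g ∈ U(σ, Φ₃)(K)` NEAR-LOWER-TRIANGULAR OF DEPTH `d` WITH COMPACT CENTRALISER HAS TWO
# `exp(−k)`-CLOSE DIAGONAL ENTRIES (`5M + 4k + 2 ≤ d`)

Cell `pub/hodgecm-mathlib`, crux H413 = `stmt-HodgeConjecture-24833`; lane `--supports stmt-HodgeConjecture-24833 --as helper` (count-neutral).  THEOREMS ONLY.  Dealer K2E3-plan (g3);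
(SC-an) line lead K2E3-p14 (g4) (RULINGS #15–#18).  The composition of ★ (FC-6a) `K2E3NearTriangularEigenvalues.exists_eigenvalues_near_diagonal` (K2E5-p01 (g4): if the
diagonal is `exp(−k)`-separated, strong Hensel gives three `K`-rational eigenvalues `λᵢ` with `v(λᵢ − gᵢᵢ) ≤ exp(3M + 2k − d)`) with ★ (FC-6b) FILE 2
`K2E3NearSingularOfCompactCentralizer.exists_v_sub_lt_of_isCompact_centralizer_of_eigenvalues` (this seat: such a `g` with COMPACT centraliser has two close diagonal
entries — else the root involution moves `λ₀` and `y_a = 1 + (a−1)e₀ + (σ(a)⁻¹−1)e₀⋆ ∈ Z_U(g)` is unbounded).  CONSUMER: (FC-8) `K2E3FinConjRankOne` (K2E3-p23 (g4)), step (iii) of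
RULINGS #15 (R15-1): on `box_d = Ω_M ∩ t_d⁻¹Ω_M t_d` the compact-centraliser locus lies in the near-collision locus, whose left-`T'`-average is small (★ FC-5 p857212).
[Rogawski1990, §3.5–§3.6] for the tori of `U(3)`; [PlatonovRapinchuk1994, §3.3] for «anisotropic ⟺ compact».

HONEST LABEL.  HC_CM is proved only modulo the 7 printed citations (2 remaining named inputs: hLiu418 = `stmt-HodgeConjecture-24832`, h413 = `stmt-HodgeConjecture-24833`)
until rung 0 closes; count-neutral helper of road FC ((SC-an) NOT ★: ★ modulo «ELL-WEIGHT at the place», ★ p857163 ∕ ★ p857198).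

## References
* [Rogawski1990] J. D. Rogawski, *Automorphic Representations of Unitary Groups in Three Variables*, Ann. of Math. Stud. 123 (1990), §3.5 p. 29, §3.6 pp. 31–32.
* [PlatonovRapinchuk1994] V. Platonov, A. Rapinchuk, *Algebraic Groups and Number Theory* (1994), §3.3.
* [NeukirchANT1999] J. Neukirch, *Algebraic Number Theory* (1999), Ch. II §4 Lemma (4.6) (Hensel).
-/

set_option autoImplicit false
-- the mandated namespace repeats the single-problem summit's segment (`HodgeConjecture.HodgeConjecture`)
set_option linter.dupNamespace false

noncomputable section

open Matrix Polynomial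
open scoped MatrixGroups WithZero
open Literature.NumberTheory.Automorphic Literature.NumberTheory.Automorphic.UnitaryGroup

namespace Summit.HodgeConjecture.HodgeConjecture.Cruxes.H413.K2E3BoxCompactCentralizerCollision

variable {K : Type*} [Field K] [Valued K ℤᵐ⁰] [ValuativeRel K] [(Valued.v : Valuation K ℤᵐ⁰).Compatible] [IsNonarchimedeanLocalField K]
  (σ : K →+* K) (hσ : ∀ x, σ (σ x) = x) (hσv : ∀ x, Valued.v (σ x) = Valued.v x)

include hσ hσv in
/-- **(FC-6) THE BOX LEMMA.**  Let `g ∈ U(σ, Φ₃)(K)` have all entries of valuation `≤ exp M`, upper entries `g₀₁, g₁₂` of valuation `≤ exp(M − d)` and `g₀₂` of valuation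
`≤ exp(M − 2d)` (i.e. `g ∈ Ω_M ∩ t_d⁻¹ Ω_M t_d`), with `5M + 4k + 2 ≤ d`.  If the centraliser `Z_U(g)` is COMPACT then two diagonal entries of `g` are `exp(−k)`-close:
`∃ i ≠ j, v(gᵢᵢ − gⱼⱼ) < exp(−k)`.  (If the diagonal were separated, ★ (FC-6a) would split `χ_g` over `K` with roots near the diagonal and ★ (FC-6b) would exhibit the non-compact
torus `{y_a}` inside `Z_U(g)`.) [cite: Rogawski1990, §3.6 pp. 31–32] [cite: PlatonovRapinchuk1994, §3.3] [cite: NeukirchANT1999, Ch. II §4 Lemma (4.6)] -/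
theorem exists_v_sub_lt_of_isCompact_centralizer {ϖ : K} (hϖ : Valued.v ϖ = WithZero.exp (-1 : ℤ)) {J : Matrix (Fin 3) (Fin 3) K}
    (hJ : J = (StdForm.antidiagonal 3).over K) {M k d : ℕ} (hd : 5 * M + 4 * k + 2 ≤ d) (g : ↥(unitaryGroupOfForm σ J))
    (hall : ∀ i j, Valued.v (((g : GL (Fin 3) K) : Matrix (Fin 3) (Fin 3) K) i j) ≤ WithZero.exp (M : ℤ))
    (h01 : Valued.v (((g : GL (Fin 3) K) : Matrix (Fin 3) (Fin 3) K) 0 1) ≤ WithZero.exp ((M : ℤ) - d))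
    (h12 : Valued.v (((g : GL (Fin 3) K) : Matrix (Fin 3) (Fin 3) K) 1 2) ≤ WithZero.exp ((M : ℤ) - d))
    (h02 : Valued.v (((g : GL (Fin 3) K) : Matrix (Fin 3) (Fin 3) K) 0 2) ≤ WithZero.exp ((M : ℤ) - 2 * d))
    (hZ : IsCompact ((Subgroup.centralizer ({g} : Set ↥(unitaryGroupOfForm σ J))) : Set ↥(unitaryGroupOfForm σ J))) :
    ∃ i j : Fin 3, i ≠ j ∧
      Valued.v (((g : GL (Fin 3) K) : Matrix (Fin 3) (Fin 3) K) i i - ((g : GL (Fin 3) K) : Matrix (Fin 3) (Fin 3) K) j j) < WithZero.exp (-(k : ℤ)) := by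
  by_contra hcon
  have hsep : ∀ i j : Fin 3, i ≠ j →
      WithZero.exp (-(k : ℤ)) ≤ Valued.v (((g : GL (Fin 3) K) : Matrix (Fin 3) (Fin 3) K) i i - ((g : GL (Fin 3) K) : Matrix (Fin 3) (Fin 3) K) j j) := by
    intro i j hij
    by_contra hlt
    exact hcon ⟨i, j, hij, not_le.1 hlt⟩
  obtain ⟨lam, hp, hlam⟩ := K2E3NearTriangularEigenvalues.exists_eigenvalues_near_diagonal hϖ ((g : GL (Fin 3) K) : Matrix (Fin 3) (Fin 3) K) M k d (by omega)
    hall h01 h12 h02 hsep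
  exact hcon (K2E3NearSingularOfCompactCentralizer.exists_v_sub_lt_of_isCompact_centralizer_of_eigenvalues σ hσ hσv hJ hd g hall h12 h02 hZ hp hlam)

end Summit.HodgeConjecture.HodgeConjecture.Cruxes.H413.K2E3BoxCompactCentralizerCollision

end
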